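import Literature.NumberTheory.Sieve.ParityBarrier
import Literature.NumberTheory.Sieve.ParityWave0Proofs
import Literature.NumberTheory.Sieve.VaughanMeanValue
import Literature.NumberTheory.LFunctions.SiegelWalfisz
import HarnessLib

/-!
# parity.S26: level of distribution of the shifted primes — assembly from Bombieri–Vinogradov

Topic `Literature/NumberTheory/Sieve`, companion ("Proofs") file of `ParityBarrier.lean` for the named
fact `Literature.NumberTheory.Sieve.shiftedPrimes_hasLevelOfDistribution`
(`∀ θ < 1/2, HasLevelOfDistribution (SieveSequence.shiftedPrimes 2) θ`: the sifted sequence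
`a_n = Λ(n + 2)`, `X(x) = x`, `g(d) = 1/φ(d)` for odd `d`, has level of distribution `x^θ` for every
`θ < 1/2`).  It is kept apart from `ParityBarrierProofs.lean` (the `Λ_k` toolkit, imported by the
asymptotic-sieve files) so that those files do not acquire the large-sieve import closure used here.

## The printed argument

The fact is the **Bombieri–Vinogradov theorem** (Bombieri, *On the large sieve*, Mathematika 12
(1965), Thm 4; A. I. Vinogradov 1965; Iwaniec–Kowalski Thm 17.1; Cojocaru–Murty, *An Introduction
to Sieve Methods and their Applications*, Thm 9.2.1, PDF pp. 98–100 of the held copy) transported to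
the sequence `Λ(n + h)` by the verification of the remainder axiom for shifted primes
(Halberstam–Richert, *Sieve Methods*, Ch. 1 Example 5 with Ch. 3 Thm 3.8).  Ford–Maynard,
arXiv:2407.14368, §1 (the cite carried by the fact) is the source of the NOTION ("Type I
information", their (I)); it states no theorem about shifted primes.

## DAG in the tree (everything below is PROVED)

* `Literature.NumberTheory.Sieve.hasLevelOfDistribution_shiftedPrimes_of_primesHaveLevel_holds` (`LevelOfDistribution.lean`):
  `PrimesHaveLevel θ → HasLevelOfDistribution (shiftedPrimes h) θ` for `h ≠ 0` — PROVED;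
* `Literature.NumberTheory.Sieve.bombieriVinogradovStatement_of_bombieri_vinogradov` (`ParityWave0Proofs.lean`):
  parity.S27 in its Wave0 form (level `x^{1/2} (log x)^{−B}`) gives `BombieriVinogradovStatement`
  (`∀ θ < 1/2, PrimesHaveLevel θ`) — PROVED;
* `Literature.NumberTheory.Sieve.bombieri_vinogradov_of_siegelWalfisz` (`VaughanMeanValue.lean`): Vaughan's mean value
  theorem (PROVED there, `vaughan_meanValue_holds`, on the PROVED large sieve) and the classical
  reduction (`BombieriVinogradovReduction.lean`) leave the **Siegel–Walfisz theorem**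
  `Literature.NumberTheory.Sieve.siegel_walfisz` (parity.S28) as the only named-fact input of parity.S27;
* `Literature.NumberTheory.LFunctions.siegel_walfisz_holds` (`Literature/NumberTheory/LFunctions/SiegelWalfisz.lean`):
  parity.S28 PROVED (Montgomery–Vaughan Cor. 11.19: zero-free region, Siegel's theorem, Landau's
  contour method).

Hence the three conditional assemblies below and the unconditional discharge
`shiftedPrimes_hasLevelOfDistribution_holds` (=
`shiftedPrimes_hasLevelOfDistribution_of_siegelWalfisz siegel_walfisz_holds`), together with the
unconditional `BombieriVinogradovStatement_holds` and the general-shift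
`hasLevelOfDistribution_shiftedPrimes`.

## Main results

* `Literature.shiftedPrimes_hasLevelOfDistribution_holds : shiftedPrimes_hasLevelOfDistribution` —
  **parity.S26 PROVED**;
* `Literature.BombieriVinogradovStatement_holds : BombieriVinogradovStatement` — the Bombieri–Vinogradov
  theorem (`∀ θ < 1/2, PrimesHaveLevel θ`), PROVED;
* `Literature.NumberTheory.Sieve.hasLevelOfDistribution_shiftedPrimes` — `Λ(n + h)`, `h ≠ 0`, has every level `θ < 1/2`.

## References

* E. Bombieri, *On the large sieve*, Mathematika 12 (1965), 201–225, Theorem 4. [Bombieri1965]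
* A. C. Cojocaru, M. R. Murty, *An Introduction to Sieve Methods and their Applications*, LMS
  Student Texts 66 (CUP, 2005), Thm 9.2.1 (PDF pp. 98–100). [CojocaruMurty2005]
* H. Halberstam, H.-E. Richert, *Sieve Methods* (1974), Ch. 1 Example 5, Ch. 3 Thm 3.8.
  [HalberstamRichert1974]
* H. Iwaniec, E. Kowalski, *Analytic Number Theory* (2004), Theorem 17.1. [IwaniecKowalski2004]
* H. L. Montgomery, R. C. Vaughan, *Multiplicative Number Theory I* (2007), Cor. 11.19.
  [MontgomeryVaughan2007]
* K. Ford, J. Maynard, *On the theory of prime producing sieves*, arXiv:2407.14368 (2024), §1.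
  [arXiv240714368]
-/

noncomputable section

namespace Literature.NumberTheory.Sieve

/-- **parity.S26 from the `ψ`-form of Bombieri–Vinogradov.** If the primes have level `x^θ` for
every `θ < 1/2` (`BombieriVinogradovStatement`, Iwaniec–Kowalski Thm 17.1), then for every shift
`h ≠ 0` the sifted sequence `Λ(n + h)` has level of distribution `x^θ` for every `θ < 1/2`
(Halberstam–Richert Ch. 1 Example 5: the remainder `R_d(x)` of the shifted primes is
`(ψ(⌊x⌋+h; d, h) − (⌊x⌋+h)/φ(d)) − (ψ(h; d, h) − h/φ(d)) + O(1/φ(d))` for `(d, h) = 1` and `≪ log x`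
otherwise; PROVED in the tree as `hasLevelOfDistribution_shiftedPrimes_of_primesHaveLevel_holds`).
[cite: HalberstamRichert1974, Ch. 1 Example 5 and Thm. 3.8] -/
theorem hasLevelOfDistribution_shiftedPrimes_of_bombieriVinogradovStatement
    (hBV : BombieriVinogradovStatement) {h : ℕ} (hh : h ≠ 0) {θ : ℝ} (hθ : θ < 1 / 2) :
    HasLevelOfDistribution (SieveSequence.shiftedPrimes h) θ :=
  hasLevelOfDistribution_shiftedPrimes_of_primesHaveLevel_holds hh (hBV θ hθ)

/-- **parity.S26 from `BombieriVinogradovStatement`** (the interim proof of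
`shiftedPrimes_hasLevelOfDistribution`, restored on the discharged transfer lemma): the shifted primes
`Λ(n + 2)` have level of distribution `x^θ` for every `θ < 1/2`. [cite: IwaniecKowalski2004, Theorem 17.1] -/
theorem shiftedPrimes_hasLevelOfDistribution_of_bombieriVinogradovStatement
    (hBV : BombieriVinogradovStatement) : shiftedPrimes_hasLevelOfDistribution :=
  fun _ hθ => hasLevelOfDistribution_shiftedPrimes_of_bombieriVinogradovStatement hBV two_ne_zero hθ

/-- **parity.S26 from parity.S27.** The Bombieri–Vinogradov theorem in its Wave0 form
`Literature.NumberTheory.Sieve.bombieri_vinogradov` (level `x^{1/2} (log x)^{−B}` with `max_{y ≤ x}`; Bombieri,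
Mathematika 12 (1965), Thm 4) implies that `Λ(n + 2)` has level of distribution `x^θ` for every
`θ < 1/2`, through the PROVED bridge `Literature.NumberTheory.Sieve.bombieriVinogradovStatement_of_bombieri_vinogradov`
(for `θ < 1/2`, `x^{θ−ε} ≤ x^{1/2} (log x)^{−B}` eventually and the summands `E*(x; q)` are
nonnegative). [cite: Bombieri1965, Theorem 4] -/
theorem shiftedPrimes_hasLevelOfDistribution_of_bombieri_vinogradov
    (hBV : Literature.NumberTheory.Sieve.bombieri_vinogradov) : shiftedPrimes_hasLevelOfDistribution :=
  shiftedPrimes_hasLevelOfDistribution_of_bombieriVinogradovStatement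
    (Literature.NumberTheory.Sieve.bombieriVinogradovStatement_of_bombieri_vinogradov hBV)

/-- **parity.S26 from the Siegel–Walfisz theorem alone.** Since Vaughan's mean value theorem and the
large sieve are proved in the tree (`Literature.NumberTheory.Sieve.vaughan_meanValue_holds`,
`Literature.NumberTheory.Sieve.large_sieve_inequality_holds`) and give parity.S27 from parity.S28
(`Literature.NumberTheory.Sieve.bombieri_vinogradov_of_siegelWalfisz`; Vaughan, Acta Arith. 37 (1980), Thm 3;
Cojocaru–Murty Thm 9.2.1), the Siegel–Walfisz theorem `Literature.NumberTheory.Sieve.siegel_walfisz` is the only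
remaining input of `shiftedPrimes_hasLevelOfDistribution`: the discharge
`shiftedPrimes_hasLevelOfDistribution_holds` is this theorem applied to a proof of `siegel_walfisz`.
[cite: CojocaruMurty2005, Thm. 9.2.1 (PDF pp. 98–100)] -/
theorem shiftedPrimes_hasLevelOfDistribution_of_siegelWalfisz (hSW : Literature.NumberTheory.Sieve.siegel_walfisz) :
    shiftedPrimes_hasLevelOfDistribution :=
  shiftedPrimes_hasLevelOfDistribution_of_bombieri_vinogradov
    (Literature.NumberTheory.Sieve.bombieri_vinogradov_of_siegelWalfisz hSW)

/-- The same for a general shift: under Siegel–Walfisz, `Λ(n + h)` (`h ≠ 0`) has level of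
distribution `x^θ` for every `θ < 1/2` (Bombieri–Vinogradov + Halberstam–Richert Ch. 1 Example 5).
[cite: HalberstamRichert1974, Ch. 1 Example 5 and Thm. 3.8] -/
theorem hasLevelOfDistribution_shiftedPrimes_of_siegelWalfisz (hSW : Literature.NumberTheory.Sieve.siegel_walfisz)
    {h : ℕ} (hh : h ≠ 0) {θ : ℝ} (hθ : θ < 1 / 2) :
    HasLevelOfDistribution (SieveSequence.shiftedPrimes h) θ :=
  hasLevelOfDistribution_shiftedPrimes_of_bombieriVinogradovStatement
    (Literature.NumberTheory.Sieve.bombieriVinogradovStatement_of_bombieri_vinogradov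
      (Literature.NumberTheory.Sieve.bombieri_vinogradov_of_siegelWalfisz hSW)) hh hθ

/-- **parity.S26, PROVED: the shifted primes have every level of distribution `θ < 1/2`.**
For every `θ < 1/2` the sifted sequence `a_n = Λ(n + 2)` (`X(x) = x`, `g(d) = 1/φ(d)` for odd `d`,
`g(d) = 0` for even `d`) satisfies `∑_{d ≤ x^θ} |r_d(x)| ≪_A x (log x)^{-A}` for every `A > 0`.
This is the Bombieri–Vinogradov theorem (Bombieri, Mathematika 12 (1965), Thm 4;
Iwaniec–Kowalski Thm 17.1; Cojocaru–Murty Thm 9.2.1) transported to `Λ(n + 2)`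
(Halberstam–Richert Ch. 1 Example 5), now unconditional: the chain
`siegel_walfisz_holds` (Montgomery–Vaughan Cor. 11.19, `SiegelWalfisz.lean`) →
`bombieri_vinogradov_of_siegelWalfisz` (Vaughan's identity + large sieve, `VaughanMeanValue.lean`) →
`shiftedPrimes_hasLevelOfDistribution_of_bombieri_vinogradov` (this file) is entirely proved in the
tree. The cite of the *fact* in `ParityBarrier.lean` (Ford–Maynard arXiv:2407.14368 §1) is for the
notion of level of distribution; the theorem itself is Bombieri's.
[cite: Bombieri1965, Theorem 4] [cite: IwaniecKowalski2004, Theorem 17.1]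
[cite: CojocaruMurty2005, Thm. 9.2.1 (PDF pp. 98–100)] -/
theorem shiftedPrimes_hasLevelOfDistribution_holds : shiftedPrimes_hasLevelOfDistribution :=
  shiftedPrimes_hasLevelOfDistribution_of_siegelWalfisz Literature.NumberTheory.LFunctions.siegel_walfisz_holds

/-- Unconditional general-shift form: for every `h ≠ 0` and `θ < 1/2`, `Λ(n + h)` has level of
distribution `x^θ`. [cite: HalberstamRichert1974, Ch. 1 Example 5 and Thm. 3.8] -/
theorem hasLevelOfDistribution_shiftedPrimes {h : ℕ} (hh : h ≠ 0) {θ : ℝ} (hθ : θ < 1 / 2) :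
    HasLevelOfDistribution (SieveSequence.shiftedPrimes h) θ :=
  hasLevelOfDistribution_shiftedPrimes_of_siegelWalfisz Literature.NumberTheory.LFunctions.siegel_walfisz_holds hh hθ

/-- Unconditional Bombieri–Vinogradov statement in the `Λ`-form used by `LevelOfDistribution.lean`
(`Literature.NumberTheory.Sieve.BombieriVinogradovStatement`: for every `θ < 1/2`, `A > 0`,
`∑_{q ≤ x^θ} max_{(a,q)=1} |ψ(x; q, a) − x/φ(q)| ≪ x (log x)^{-A}`).
[cite: Bombieri1965, Theorem 4] [cite: IwaniecKowalski2004, Theorem 17.1] -/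
theorem BombieriVinogradovStatement_holds : BombieriVinogradovStatement :=
  Literature.NumberTheory.Sieve.bombieriVinogradovStatement_of_bombieri_vinogradov
    (Literature.NumberTheory.Sieve.bombieri_vinogradov_of_siegelWalfisz Literature.NumberTheory.LFunctions.siegel_walfisz_holds)

/-- **Discharge of the `ParityBarrier.lean` fact `bombieriVinogradovStatement`** (the Bombieri–Vinogradov
theorem in level-of-distribution form: the primes have level `x^θ` for every `θ < 1/2`, i.e. for all
`A > 0`, `ε > 0`, `∑_{q ≤ x^{θ−ε}} max_{y ≤ x} max_{(a,q)=1} |ψ(y; q, a) − y/φ(q)| ≪ x (log x)^{−A}`;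
Bombieri, *On the large sieve*, Mathematika 12 (1965), Thm 4; A. I. Vinogradov, *The density
hypothesis for Dirichlet L-series*, Izv. Akad. Nauk SSSR Ser. Mat. 29 (1965), 903–934, with the
correction ibid. 30 (1966), 719–720; Iwaniec–Kowalski Thm 17.1). The fact is by definition the prelude
statement `BombieriVinogradovStatement`, PROVED above as `BombieriVinogradovStatement_holds` along the
tree's chain `siegel_walfisz_holds` (Montgomery–Vaughan Cor. 11.19) → `bombieri_vinogradov_of_siegelWalfisz`
(Vaughan's identity + the large sieve) → `bombieriVinogradovStatement_of_bombieri_vinogradov`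
(`x^{θ−ε} ≤ x^{1/2} (log x)^{−B}` eventually, nonnegative summands); no new hypothesis enters.
[cite: Vinogradov1965] [cite: Bombieri1965, Theorem 4] [cite: IwaniecKowalski2004, Theorem 17.1]
[cite: CojocaruMurty2005, Thm. 9.2.1 (PDF p. 98)] -/
theorem bombieriVinogradovStatement_holds : bombieriVinogradovStatement :=
  BombieriVinogradovStatement_holds

end Literature.NumberTheory.Sieve
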